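import Mathlib
import Summits.KontsevichZagierPeriods.KontsevichZagierPeriods.Theorems.SoloInformedRealParamBarrierI
import HarnessLib

/-!
# Solo-informed (A390-ii): THEOREM T for ARBITRARY `KZ_ℝ` chains (kernel form, conditional on
generator definability)

File F6f.  **Conservativity of real parameters, unbounded chains.** If the four generators of
`KZ_ℝ` satisfy the definability invariant `SoloInformedDefinableRelI`, then for ANY integral
representations `r, r'` over `ℚ`: `KZ_ℝ`-equivalence of `r ⊗ ℝ` and `r' ⊗ ℝ` (a chain of the four
Kontsevich–Zagier moves with REAL semialgebraic data, no boundedness) implies `KZ_ℚ`-equivalence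
of `r` and `r'` (`soloInformed_realParameterTransferI`); equivalently
`KZOver.Equivalent (r ⊗ ℝ) (r' ⊗ ℝ) ↔ KZOver.Equivalent r r'`, and for Kontsevich–Zagier's own
representations `KZ_ℝ`-equivalence is KZ-equivalence (`soloInformed_kzEquivalent_iff_realI`).
The proof is that of the bounded case (`SoloInformedRealParamTransferBdd`) with I-admissible
denotations; the on-domain congruence lands in the full module `KZOver.relations ℚ`.

References: [cite: KontsevichZagier2001, §1.2]; [cite: BochnakCosteRoy1998, Prop. 2.2.4, 5.2.3].
-/

noncomputable section

open Set MeasureTheory MvPolynomial Literature.ModelTheory.ExponentialFields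
  Literature.NumberTheory.Transcendental

namespace Summit.KontsevichZagierPeriods.KontsevichZagierPeriods.Theorems

/-- **THEOREM T (arbitrary chains).** Conditional on definability of the generators of `KZ_ℝ`:
`KZ_ℝ`-equivalence of the base changes of two `ℚ`-representations implies `KZ_ℚ`-equivalence.
[cite: KontsevichZagier2001, §1.2, Conjecture 1] -/
theorem soloInformed_realParameterTransferI
    (hgen : ∀ c ∈ soloInformedGenerators ℝ, SoloInformedDefinableRelI c)
    {n n' : ℕ} (r : KZOver.IntegralRep ℚ n) (r' : KZOver.IntegralRep ℚ n')
    (hc : KZOver.of (r.baseChange ℝ) - KZOver.of (r'.baseChange ℝ) ∈ KZOver.relations ℝ) :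
    KZOver.of r - KZOver.of r' ∈ KZOver.relations ℚ := by
  classical
  -- degenerate case: literally the same representation
  by_cases hAB : (⟨n, r.baseChange ℝ⟩ : Σ m, KZOver.IntegralRep ℝ m) = ⟨n', r'.baseChange ℝ⟩
  · obtain ⟨h, hcast⟩ := (SoloInformedPTerm.sigma_mk_eq_iff _ _).1 hAB
    have hrr : SoloInformedPTerm.castRep h r = r' :=
      (SoloInformedPTerm.castRep_eq_iff h r r').2 hcast
    rw [← hrr, SoloInformedPTerm.of_castRep, sub_self]
    exact zero_mem _
  obtain ⟨K, hK, P, p₀, V, hV, hp₀, hcombo, hgood, hrat⟩ :=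
    soloInformed_definableRelI_of_mem_relations hgen hc
  haveI : Fintype K := hK
  let cA : SoloInformedPTerm K n := SoloInformedPTerm.const K r
  let cB : SoloInformedPTerm K n' := SoloInformedPTerm.const K r'
  have hAadm : ∀ p, cA.SoloInformedAdmI p := fun p => SoloInformedPTerm.admI_const r p
  have hBadm : ∀ p, cB.SoloInformedAdmI p := fun p => SoloInformedPTerm.admI_const r' p
  let Valid : (K → ℝ) → Prop := fun p => p ∈ V ∧
    (∀ t t' (h : P.dim t = P.dim t'), P.keyI p₀ t = P.keyI p₀ t' →
      ((P.term t).castDim h).SoloInformedCoin (P.term t') p) ∧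
    (∀ t (h : P.dim t = n), P.keyI p₀ t = ⟨n, r.baseChange ℝ⟩ →
      ((P.term t).castDim h).SoloInformedCoin cA p) ∧
    (∀ t (h : P.dim t = n'), P.keyI p₀ t = ⟨n', r'.baseChange ℝ⟩ →
      ((P.term t).castDim h).SoloInformedCoin cB p)
  -- (1) the clause set is `ℚ`-semialgebraic
  have hValid : IsSemialgebraic ℚ {p | Valid p} := by
    refine soloInformed_isSemialgebraic_setOf_and hV
      (soloInformed_isSemialgebraic_setOf_and ?_ (soloInformed_isSemialgebraic_setOf_and ?_ ?_))
    · exact soloInformed_isSemialgebraic_setOf_forall fun t =>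
        soloInformed_isSemialgebraic_setOf_forall fun t' =>
        soloInformed_isSemialgebraic_setOf_forall_prop fun h =>
        soloInformed_isSemialgebraic_setOf_imp (soloInformed_isSemialgebraic_setOf_const _)
          (SoloInformedPTerm.isSemialgebraic_setOf_coin _ _)
    · exact soloInformed_isSemialgebraic_setOf_forall fun t =>
        soloInformed_isSemialgebraic_setOf_forall_prop fun h =>
        soloInformed_isSemialgebraic_setOf_imp (soloInformed_isSemialgebraic_setOf_const _)
          (SoloInformedPTerm.isSemialgebraic_setOf_coin _ _)
    · exact soloInformed_isSemialgebraic_setOf_forall fun t =>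
        soloInformed_isSemialgebraic_setOf_forall_prop fun h =>
        soloInformed_isSemialgebraic_setOf_imp (soloInformed_isSemialgebraic_setOf_const _)
          (SoloInformedPTerm.isSemialgebraic_setOf_coin _ _)
  -- (2) the original parameter satisfies the clauses
  have hadm₀ : P.SoloInformedAdmI p₀ := (hgood p₀ hp₀).1
  have hValid₀ : Valid p₀ := by
    refine ⟨hp₀, fun t t' h hk => ?_, fun t h hk => ?_, fun t h hk => ?_⟩
    · obtain ⟨h', hk'⟩ := (SoloInformedPTerm.sigma_mk_eq_iff _ _).1 hk
      refine SoloInformedPTerm.coin_of_repI_eq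
        ((SoloInformedPTerm.admI_castDim_iff h _ _).2 (hadm₀ t)) (hadm₀ t') ?_
      rw [SoloInformedPTerm.repI_castDim]
      exact hk'
    · obtain ⟨h', hk'⟩ := (SoloInformedPTerm.sigma_mk_eq_iff _ _).1 hk
      refine SoloInformedPTerm.coin_of_repI_eq
        ((SoloInformedPTerm.admI_castDim_iff h _ _).2 (hadm₀ t)) (hAadm _) ?_
      rw [SoloInformedPTerm.repI_castDim, SoloInformedPTerm.repI_const r _]
      exact hk'
    · obtain ⟨h', hk'⟩ := (SoloInformedPTerm.sigma_mk_eq_iff _ _).1 hk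
      refine SoloInformedPTerm.coin_of_repI_eq
        ((SoloInformedPTerm.admI_castDim_iff h _ _).2 (hadm₀ t)) (hBadm _) ?_
      rw [SoloInformedPTerm.repI_castDim, SoloInformedPTerm.repI_const r' _]
      exact hk'
  -- (3) an algebraic good parameter with `ℚ`-semialgebraic fibres
  let e := Fintype.equivFin K
  have hVe : IsSemialgebraic ℚ {c : Fin (Fintype.card K) → ℝ | Valid (c ∘ e)} :=
    hValid.preimage_comp e
  have h₀e : Valid ((p₀ ∘ e.symm) ∘ e) := by
    have : (p₀ ∘ e.symm) ∘ e = p₀ := by ext i; simp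
    rw [this]
    exact hValid₀
  obtain ⟨c₁, hc₁V, -, hc₁F⟩ := soloInformed_realParameter_transfer_core hVe h₀e
  have hRF : SoloInformedRatFibres (c₁ ∘ e) := soloInformedRatFibres_comp (p' := c₁) hc₁F e
  obtain ⟨hp₁V, hcl, hclA, hclB⟩ := hc₁V
  have hadm : P.SoloInformedAdmI (c₁ ∘ e) := (hgood _ hp₁V).1
  obtain ⟨q, hq, hqrel⟩ := hrat _ hp₁V hRF
  -- (4) the class-function principle in `FormalRep ℚ ⧸ relations ℚ`
  let N := KZOver.relations ℚ
  let π : KZOver.FormalRep ℚ →+ KZOver.FormalRep ℚ ⧸ N := QuotientAddGroup.mk' N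
  have hπ : ∀ x y : KZOver.FormalRep ℚ, π x = π y ↔ x - y ∈ N := fun x y => by
    simp only [π]
    rw [QuotientAddGroup.mk'_apply, QuotientAddGroup.mk'_apply, QuotientAddGroup.eq_iff_sub_mem]
  have hstep : ∀ (t : P.ι) {m : ℕ} (h : P.dim t = m) (C : SoloInformedPTerm K m)
      (y : KZOver.IntegralRep ℚ m), C.SoloInformedAdmI (c₁ ∘ e) →
      C.repI (c₁ ∘ e) = y.baseChange ℝ → ((P.term t).castDim h).SoloInformedCoin C (c₁ ∘ e) →
      π (KZOver.of (q t)) = π (KZOver.of y) := by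
    intro t m h C y hC hCy hcoin
    have hTadm : ((P.term t).castDim h).SoloInformedAdmI (c₁ ∘ e) :=
      (SoloInformedPTerm.admI_castDim_iff h _ _).2 (hadm t)
    obtain ⟨hd, hi⟩ := SoloInformedPTerm.repI_congr_of_coin hcoin hTadm hC
    have hrepT : ((P.term t).castDim h).repI (c₁ ∘ e) =
        (SoloInformedPTerm.castRep h (q t)).baseChange ℝ := by
      rw [SoloInformedPTerm.repI_castDim, SoloInformedPTerm.baseChange_castRep, hq t]
    rw [hrepT, hCy] at hd hi
    have hmem : KZOver.of (SoloInformedPTerm.castRep h (q t)) - KZOver.of y ∈ N :=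
      soloInformed_sub_mem_relations_of_eqOn hd hi
    rw [SoloInformedPTerm.of_castRep] at hmem
    exact (hπ _ _).2 hmem
  have hsum := P.sum_eq_of_comboI_eq_sub hcombo hAB (fun t => π (KZOver.of (q t)))
    (π (KZOver.of r)) (π (KZOver.of r')) ?_ ?_ ?_
  · have hzero : ∑ t, P.coef t • π (KZOver.of (q t)) = 0 := by
      have : π (∑ t, P.coef t • KZOver.of (q t)) = ∑ t, P.coef t • π (KZOver.of (q t)) := by
        rw [map_sum]
        simp only [map_zsmul]
      rw [← this]
      simp only [π]
      rw [QuotientAddGroup.mk'_apply, QuotientAddGroup.eq_zero_iff]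
      exact hqrel
    rw [hzero, eq_comm, sub_eq_zero] at hsum
    exact (hπ _ _).1 hsum
  · intro t t' hk
    have h : P.dim t = P.dim t' := congrArg Sigma.fst hk
    exact hstep t h (P.term t') (q t') (hadm t') (hq t').symm (hcl t t' h hk)
  · intro t hk
    have h : P.dim t = n := congrArg Sigma.fst hk
    exact hstep t h cA r (hAadm _) (SoloInformedPTerm.repI_const r _) (hclA t h hk)
  · intro t hk
    have h : P.dim t = n' := congrArg Sigma.fst hk
    exact hstep t h cB r' (hBadm _) (SoloInformedPTerm.repI_const r' _) (hclB t h hk)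

/-- **Corollary (the two calculi agree on `ℚ`-defined periods).** Under the same hypothesis,
`KZ_ℝ`-equivalence of base changes of `ℚ`-representations is EQUIVALENT to `KZ_ℚ`-equivalence.
[cite: KontsevichZagier2001, §1.2] -/
theorem soloInformed_equivalent_baseChange_iffI
    (hgen : ∀ c ∈ soloInformedGenerators ℝ, SoloInformedDefinableRelI c)
    {n n' : ℕ} (r : KZOver.IntegralRep ℚ n) (r' : KZOver.IntegralRep ℚ n') :
    KZOver.Equivalent (r.baseChange ℝ) (r'.baseChange ℝ) ↔ KZOver.Equivalent r r' :=
  ⟨soloInformed_realParameterTransferI hgen r r', fun h => h.baseChange ℝ⟩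

/-- **Corollary (Kontsevich–Zagier's representations).** Under the same hypothesis, for KZ's own
integral representations `KZ_ℝ`-equivalence of their images in the calculus over `ℝ` is exactly
KZ-equivalence: real semialgebraic parameters in the moves prove no new identity between
periods with rational representations. [cite: KontsevichZagier2001, §1.2, Conjecture 1] -/
theorem soloInformed_kzEquivalent_iff_realI
    (hgen : ∀ c ∈ soloInformedGenerators ℝ, SoloInformedDefinableRelI c)
    {n n' : ℕ} (r : KZ.IntegralRep n) (r' : KZ.IntegralRep n') :
    KZOver.Equivalent (KZOver.IntegralRep.ofKZOver ℝ r) (KZOver.IntegralRep.ofKZOver ℝ r') ↔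
      KZ.Equivalent r r' := by
  rw [← KZOver.equivalent_ofKZ_iff]
  exact soloInformed_equivalent_baseChange_iffI hgen _ _

end Summit.KontsevichZagierPeriods.KontsevichZagierPeriods.Theorems
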